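import Mathlib
import HarnessLib
import Literature.AlgebraicGeometry.Ramification.InertiaNormalSylow
import Literature.AlgebraicGeometry.Resolution.ResolutionOfSingularities
import Literature.AlgebraicGeometry.Resolution.BlowupSNC
import Literature.AlgebraicGeometry.Resolution.BoundarySplitting
import Literature.AlgebraicGeometry.Resolution.CanonicalResolutionSmoothCentre
import Summits.ResolutionOfSingularities.ResolutionOfSingularities.Theorems.WildQuotientsWildQuotientResolutionTameMove
import Summits.ResolutionOfSingularities.ResolutionOfSingularities.Theorems.WildQuotientsWildQuotientResolutionStandardFormTransport
import Summits.ResolutionOfSingularities.ResolutionOfSingularities.Theorems.WildQuotientsWildQuotientResolutionStandardFormStableLines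

/-!
# Phase 0 in EVERY dimension for groups with a TAME CORE: one tame move
# (crux `WildQuotients.WildQuotientResolution`, stub `stub_phaseZeroHighDim`)

Crux stmt-ResolutionOfSingularities-15640 (`WildQuotientResolution`), registered stub `stub_phaseZeroHighDim`
(Phase 0 for `dim X′ ≥ 3`: an equivariant proper birational REGULAR model with every inertia group p-closed and a
`G`-stable affine cover). This file generalises the prime-core slice (`…PrimeCorePhaseZero`, same session) to the
natural hypothesis under which ONE tame move along ONE `G`-stable regular centre reaches the standard-form end
state everywhere:

**Theorem** (`phaseZero_of_tameCore`). Let `M ⊴ G` be a normal subgroup, `M ≠ 1`, of order prime to `p` — the TAME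
CORE — such that in every subgroup `H ≤ G` WITHOUT a normal Sylow `p`-subgroup, every element `h ≠ 1` of order
prime to `p` has `M ≤ ⟨h⟩`. Then for EVERY crux datum (`X′` integral regular of any dimension, finite over the
separated finite-type `X₁/k`, `char k = p`, faithful action over `q`) the conclusion of `stub_phaseZeroHighDim`
holds, the model being the blow-up of the reduced inert locus `Z_M = {y | M ≤ I_y}` (✓`tameMove`, p819797).

Examples (`hcore_of_forall_le_zpowers`): every `G` whose tame cyclic subgroups all contain a fixed normal `M ≠ 1`
— extensions of a `p`-group by a CYCLIC group of prime-power order `ℓ^a` (`M` = its subgroup of order `ℓ`;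
dihedral and dicyclic groups in characteristic `2` with `ℓ^a` rotations, `C_{ℓ^a} ⋊ P`), and, for `p` odd,
groups whose `p′`-elements lie in a normal generalised quaternion subgroup, e.g. **`SL₂(𝔽₃) = Q₈ ⋊ C₃` in
characteristic `3`** (`M = {±1}`: every element of `Q₈` other than `1` has `−1` among its powers).

Proof. Let `x ∈ X♯` with `I_x` not p-closed. Then `I_x` has an element `h ≠ 1` of order prime to `p`
(`exists_ne_one_coprime_of_not_hasNormalSylow`), so `M ≤ ⟨h⟩ ≤ I_x ≤ I_{π x}` (✓`stub_inertia_le`): `π x ∈ Z_M`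
and `x` lies on the exceptional divisor `E = π⁻¹ Z_M`. `Z_M` is a regular `G`-stable centre of the regular `X′`
(✓`InertLocusCentre`, `hasSNCWith_nil_of_isRegular`), so `[E]` is a simple normal crossings boundary on `X♯`
(✓`HasSNCWith.hasSNC_transform`): `I(E)_x = (t)`, `t ∈ 𝔪_x ∖ 𝔪_x²`, and `E` is `G`-stable, so `κ t̄` is an
`I_x`-stable line (✓`StandardFormStableLines`, p821951). Every `g ≠ 1` in `I_x` of order prime to `p` has
`M ≤ ⟨g⟩`, hence `Z_⟨g⟩ ⊆ Z_M` = the centre, and `t ∈ 𝔞_{τ g}` (ESTABLISHMENT, ✓`StandardFormTransport`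
p821870). The standard-form criterion (✓p821758/p821673) says `I_x` is p-closed — contradiction.

[OURS · crux stmt-ResolutionOfSingularities-15640 · helper toward `stub_phaseZeroHighDim` (an all-dimensional
SLICE of the stub — groups with a tame core; NOT a proof of the stub); counted 0; AI-level work, weaker than
expert review.] [folklore]
-/

-- single-problem summit: the doubled namespace component `ResolutionOfSingularities` is forced
set_option linter.dupNamespace false

noncomputable section

open CategoryTheory AlgebraicGeometry TopologicalSpace IsLocalRing
open Literature.AlgebraicGeometry.Resolution Literature.AlgebraicGeometry.Ramification
open Scheme.IdealSheafData
open Summit.ResolutionOfSingularities.ResolutionOfSingularities.Theorems.WildQuotientResolution.PointBlowupStalkData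
open Summit.ResolutionOfSingularities.ResolutionOfSingularities.Theorems.WildQuotientResolution.InertLocusStalk

namespace Summit.ResolutionOfSingularities.ResolutionOfSingularities.Theorems.WildQuotientResolution.StandardForm

/-! ## Group theory of the tame-core hypothesis -/

section Group

variable {G : Type} [Group G]

/-- A finite group without a normal Sylow `p`-subgroup has a non-trivial element of order prime to `p`
(otherwise it is a `p`-group, ✓`isPGroup_of_forall_coprime_eq_one`). [folklore] -/
theorem exists_ne_one_coprime_of_not_hasNormalSylow {p : ℕ} [Fact p.Prime] [Finite G] (H : Subgroup G)
    (hH : ¬ HasNormalSylow p H) : ∃ h ∈ H, h ≠ 1 ∧ (orderOf h).Coprime p := by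
  by_contra hne
  push Not at hne
  refine hH (HasNormalSylow.of_isPGroup (isPGroup_of_forall_coprime_eq_one fun g hg => ?_))
  by_contra hg1
  have h1 : (g : G) ≠ 1 := fun h => hg1 (Subtype.ext h)
  exact hne g g.2 h1 (by rwa [Subgroup.orderOf_coe])

/-- **The tame-core hypothesis from cyclic containment**: if every non-trivial element of `G` of order prime to
`p` has `M` among its powers' subgroup (`M ≤ ⟨h⟩`), then a fortiori so does every such element of every subgroup
without a normal Sylow `p`-subgroup. (E.g. `G ⧸ N` a `p`-group with `N` cyclic of prime-power order `ℓ^a` and `M`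
its subgroup of order `ℓ`; `SL₂(𝔽₃)` with `p = 3`, `M = {±1}`.) [folklore] -/
theorem hcore_of_forall_le_zpowers (p : ℕ) (M : Subgroup G)
    (h : ∀ g : G, g ≠ 1 → (orderOf g).Coprime p → M ≤ Subgroup.zpowers g) (H : Subgroup G)
    (_hH : ¬ HasNormalSylow p H) : ∀ g ∈ H, g ≠ 1 → (orderOf g).Coprime p → M ≤ Subgroup.zpowers g :=
  fun g _ hg1 hg => h g hg1 hg

end Group

/-! ## The theorem -/

/-- **Phase 0 in every dimension for groups with a tame core** (crux stmt-ResolutionOfSingularities-15640, a SLICE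
of `stub_phaseZeroHighDim` valid in all dimensions). Let `M ⊴ G`, `M ≠ 1`, have order prime to `p`, and suppose
that in every subgroup of `G` without a normal Sylow `p`-subgroup every element `h ≠ 1` of order prime to `p` has
`M ≤ ⟨h⟩` (`hcore`). Then for the crux data — `k` of characteristic `p`, `X₁/k` separated of finite type, `X′`
integral REGULAR (any dimension), `q : X′ → X₁` finite, `ρ` a faithful action over `q` — there is an equivariant
proper birational regular model with a `G`-stable affine cover all of whose inertia groups have a normal Sylow
`p`-subgroup: the blow-up of the reduced inert locus `Z_M`. [folklore] -/
theorem phaseZero_of_tameCore (p : ℕ) (hp : p.Prime) (k : Type) [Field k] [CharP k p]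
    (X' X₁ : Scheme.{0}) (f : X₁ ⟶ Spec (.of k)) (q : X' ⟶ X₁) (G : Type) [Group G] [Finite G]
    (ρ : G →* Aut X') (hfaith : Function.Injective ρ)
    [IsSeparated f] [LocallyOfFiniteType f] [QuasiCompact f] [IsIntegral X']
    (hreg : Scheme.IsRegular X') [IsFinite q] (hρ : ∀ g : G, (ρ g).hom ≫ q = q)
    (M : Subgroup G) [M.Normal] (hM : M ≠ ⊥) (hcop : (Nat.card M).Coprime p)
    (hcore : ∀ H : Subgroup G, ¬ HasNormalSylow p H →
      ∀ h ∈ H, h ≠ 1 → (orderOf h).Coprime p → M ≤ Subgroup.zpowers h) :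
    ∃ (Xs : Scheme.{0}) (π : Xs ⟶ X') (ρs : G →* Aut Xs), IsProper π ∧ IsBirational π ∧
      IsIntegral Xs ∧ Scheme.IsRegular Xs ∧ (∀ g : G, (ρs g).hom ≫ π = π ≫ (ρ g).hom) ∧
      (∀ x : Xs, HasNormalSylow p (inertiaSubgroup ρs x)) ∧
      ∀ x : Xs, ∃ U : Xs.Opens, IsAffineOpen U ∧ x ∈ U ∧ ∀ g : G, (ρs g).hom ⁻¹ᵁ U = U := by
  haveI : Fact p.Prime := ⟨hp⟩
  haveI : IsLocallyNoetherian X' := LocallyOfFiniteType.isLocallyNoetherian (q ≫ f)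
  -- residue characteristics of `X′`
  have hcharX : ∀ z : X', CharP (ResidueField (X'.presheaf.stalk z)) p := fun z =>
    (((IsLocalRing.residue (X'.presheaf.stalk z)).comp ((X'.presheaf.germ ⊤ z trivial).hom.comp
      (((q ≫ f).appTop).hom.comp (Scheme.ΓSpecIso (.of k)).inv.hom))).charP_iff_charP p).mp
      inferInstance
  -- THE TAME MOVE along `Z_M`
  obtain ⟨Xs, π, ρs, hπp, hbir, hXs, hXsreg, hequiv, hπ, hle, hcov⟩ :=
    tameMove p hp k X' X₁ f q G ρ hfaith hreg hρ M hM hcop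
  haveI := hπp; haveI := hXs
  haveI : IsLocallyNoetherian Xs := LocallyOfFiniteType.isLocallyNoetherian (π ≫ q ≫ f)
  have hZ : IsClosed {y : X' | M ≤ inertiaSubgroup ρ y} :=
    PointMoveNoNpcCurves.isClosed_setOf_le_inertia q ρ hρ M
  set Z : Closeds X' := ⟨{y : X' | M ≤ inertiaSubgroup ρ y}, hZ⟩ with hZdef
  set 𝒥 : X'.IdealSheafData := vanishingIdeal Z with h𝒥def
  -- the exceptional divisor `[π⁻¹𝒥]` is a simple normal crossings boundary on `X♯`
  have hC : Scheme.IsRegular 𝒥.subscheme :=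
    isRegular_subscheme_vanishingIdeal_inertLocus_of_coprime ρ M p hZ (fun x _ => hreg x)
      (fun x _ => hcharX x) hcop
  have hsnc : HasSNC (([] : List X'.IdealSheafData).map (strictTransformIdeal π 𝒥) ++ [𝒥.comap π]) :=
    (hasSNCWith_nil_of_isRegular hreg hC).hasSNC_transform hπ
  set D : Xs.IdealSheafData := 𝒥.comap π with hDdef
  have hDmem : D ∈ ([] : List X'.IdealSheafData).map (strictTransformIdeal π 𝒥) ++ [𝒥.comap π] := by
    simp [hDdef]
  -- `supp D = π⁻¹ Z_M`, a `G`-stable closed set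
  have hDsupp : (D.support : Set Xs) = π.base ⁻¹' {y : X' | M ≤ inertiaSubgroup ρ y} := by
    rw [hDdef, support_comap]
    change π.base ⁻¹' ((𝒥.support : Closeds X') : Set X') = _
    rw [h𝒥def, Scheme.IdealSheafData.coe_support_vanishingIdeal]
    rfl
  have hρs : ∀ g : G, (ρs g).hom ≫ (π ≫ q ≫ f) = π ≫ q ≫ f := fun g => by
    rw [← Category.assoc, hequiv g, Category.assoc, ← Category.assoc (ρ g).hom, hρ g]
  have hDstab : ∀ g : G, (ρs g).hom.base ⁻¹' (D.support : Set Xs) = D.support := by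
    intro g
    have hcomm : π.base ∘ (ρs g).hom.base = (ρ g).hom.base ∘ π.base := by
      funext y
      have e := Scheme.Hom.comp_apply (ρs g).hom π y
      rw [hequiv g, Scheme.Hom.comp_apply] at e
      exact e.symm
    rw [hDsupp, ← Set.preimage_comp, hcomm, Set.preimage_comp, preimage_inertLocus_of_normal ρ g M]
  -- residue characteristics of `X♯`
  have hcharS : ∀ x : Xs, CharP (ResidueField (Xs.presheaf.stalk x)) p := fun x =>
    (((IsLocalRing.residue (Xs.presheaf.stalk x)).comp ((Xs.presheaf.germ ⊤ x trivial).hom.comp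
      (((π ≫ q ≫ f).appTop).hom.comp (Scheme.ΓSpecIso (.of k)).inv.hom))).charP_iff_charP p).mp
      inferInstance
  refine ⟨Xs, π, ρs, hπp, hbir, hXs, hXsreg, hequiv, fun x => ?_, hcov⟩
  haveI := hcharS x
  haveI := hXsreg x
  by_contra hnpc
  have htame := hcore (inertiaSubgroup ρs x) hnpc
  -- `x` lies on the exceptional divisor: `M ≤ ⟨h⟩ ≤ I_x ≤ I_{π x}` for a tame `h ≠ 1` of `I_x`
  obtain ⟨h, hhI, hh1, hhcop⟩ := exists_ne_one_coprime_of_not_hasNormalSylow (inertiaSubgroup ρs x) hnpc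
  have hMle : M ≤ inertiaSubgroup ρs x :=
    le_trans (htame h hhI hh1 hhcop) ((Subgroup.zpowers_le).mpr hhI)
  have hπx : π.base x ∈ {y : X' | M ≤ inertiaSubgroup ρ y} := le_trans hMle (hle x)
  have hxD : x ∈ D.support := by
    change x ∈ (D.support : Set Xs)
    rw [hDsupp]
    exact hπx
  -- the local equation `t` of `E` at `x`: a regular parameter generating `D_x = I(E)_x`
  obtain ⟨hregx, u, hu, ⟨ι, -, hι⟩, -⟩ := hsnc x
  have hrsop : IsRsopPart (u ∘ id) := isRsopPart_comp_of_rsop rfl u hu id Function.injective_id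
  set i₀ := ι ⟨D, hDmem, hxD⟩ with hi₀
  set t : Xs.presheaf.stalk x := u i₀ with htdef
  have ht : stalkIdeal D x = Ideal.span {t} := hι ⟨D, hDmem, hxD⟩
  have htm : t ∈ maximalIdeal (Xs.presheaf.stalk x) := hu ▸ Ideal.subset_span ⟨i₀, rfl⟩
  have ht2 : t ∉ maximalIdeal (Xs.presheaf.stalk x) ^ 2 := hrsop.not_mem_sq i₀
  have htE : stalkIdeal (vanishingIdeal D.support) x = Ideal.span {t} := by
    rw [hsnc.vanishingIdeal_support hDmem, ht]
  -- closed inert loci upstairs (separated invariant structure map `π ≫ q ≫ f`)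
  have hZ' : ∀ K : Subgroup G, IsClosed {x' : Xs | K ≤ inertiaSubgroup ρs x'} := fun K =>
    PointMoveNoNpcCurves.isClosed_setOf_le_inertia (π ≫ q ≫ f) ρs hρs K
  -- the standard-form criterion with the single boundary equation `t`
  refine hnpc (hasNormalSylow_inertia_of_standardForm ρs p x fun a τ hkey hτ =>
    ⟨1, fun _ => t, fun _ => htm, fun _ => ht2, fun g _ => ?_, fun g hg1 hg => ⟨0, ?_⟩⟩)
  · -- (hstab): `E` is `G`-stable, so `κ t̄` is an `I_x`-stable line
    exact apply_mem_span_of_stalkIdeal_eq_span ρs x a τ hkey hτ D.support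
      (fun g => hDstab (g : G)) htE g
  · -- (hfix): a tame `g ≠ 1` of `I_x` has `M ≤ ⟨g⟩`, so `Z_⟨g⟩ ⊆ Z_M` = the centre, and `t ∈ 𝔞_{τ g}`
    have hg1' : (g : G) ≠ 1 := fun h => hg1 (Subtype.ext h)
    have hMg : M ≤ Subgroup.zpowers (g : G) := htame (g : G) g.2 hg1' (by rwa [Subgroup.orderOf_coe])
    have hW : {y : X' | Subgroup.zpowers (g : G) ≤ inertiaSubgroup ρ y} ⊆ (Z : Set X') :=
      fun y hy => le_trans hMg hy
    have htD : t ∈ stalkIdeal (𝒥.comap π) x := by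
      rw [← hDdef, ht]
      exact Ideal.mem_span_singleton_self t
    exact Ideal.mem_sup_left
      (mem_augIdeal_of_mem_stalkIdeal_comap ρs ρ π hequiv p x a τ hkey hτ g hg g.2 Z le_rfl hW
        (hZ' _) htD)

/-- **Corollary: one normal subgroup inside every tame cyclic subgroup.** If `M ⊴ G`, `M ≠ 1`, `|M|` prime to
`p`, and EVERY non-trivial element of `G` of order prime to `p` has `M ≤ ⟨g⟩` — e.g. `G` an extension of a
`p`-group by a cyclic group of prime-power order `ℓ^a ≠ p^·` (`M` the subgroup of order `ℓ`), or `p` odd and the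
`p′`-elements of `G` inside a normal generalised quaternion subgroup (`SL₂(𝔽₃)` in characteristic `3`,
`M = {±1}`) — then Phase 0 holds for the faithful actions of `G` on regular varieties of every dimension.
[folklore] -/
theorem phaseZero_of_forall_le_zpowers (p : ℕ) (hp : p.Prime) (k : Type) [Field k] [CharP k p]
    (X' X₁ : Scheme.{0}) (f : X₁ ⟶ Spec (.of k)) (q : X' ⟶ X₁) (G : Type) [Group G] [Finite G]
    (ρ : G →* Aut X') (hfaith : Function.Injective ρ)
    [IsSeparated f] [LocallyOfFiniteType f] [QuasiCompact f] [IsIntegral X']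
    (hreg : Scheme.IsRegular X') [IsFinite q] (hρ : ∀ g : G, (ρ g).hom ≫ q = q)
    (M : Subgroup G) [M.Normal] (hM : M ≠ ⊥) (hcop : (Nat.card M).Coprime p)
    (h : ∀ g : G, g ≠ 1 → (orderOf g).Coprime p → M ≤ Subgroup.zpowers g) :
    ∃ (Xs : Scheme.{0}) (π : Xs ⟶ X') (ρs : G →* Aut Xs), IsProper π ∧ IsBirational π ∧
      IsIntegral Xs ∧ Scheme.IsRegular Xs ∧ (∀ g : G, (ρs g).hom ≫ π = π ≫ (ρ g).hom) ∧
      (∀ x : Xs, HasNormalSylow p (inertiaSubgroup ρs x)) ∧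
      ∀ x : Xs, ∃ U : Xs.Opens, IsAffineOpen U ∧ x ∈ U ∧ ∀ g : G, (ρs g).hom ⁻¹ᵁ U = U :=
  phaseZero_of_tameCore p hp k X' X₁ f q G ρ hfaith hreg hρ M hM hcop (hcore_of_forall_le_zpowers p M h)

end Summit.ResolutionOfSingularities.ResolutionOfSingularities.Theorems.WildQuotientResolution.StandardForm

end
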